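import Mathlib.AlgebraicGeometry.Morphisms.Proper
import Mathlib.RingTheory.Finiteness.Defs
import Literature.AlgebraicGeometry.Morphisms.FormalFunctions
import HarnessLib

/-!
# Čech `H¹(X, 𝒪_X)` of an open cover; finiteness for proper `X → Spec A` (Stacks 02O5)

For a scheme `f : X → Spec A` over a ring `A` and a family of opens `U : ι → X.Opens` we define,
with Mathlib primitives only, the (full, ordered) Čech complex of the structure sheaf in degrees
`0, 1, 2` as `A`-modules — `Č⁰ = Π_i Γ(X, U_i)`, `Č¹ = Π_{i,j} Γ(X, U_i ∩ U_j)`,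
`Č² = Π_{i,j,k} Γ(X, U_i ∩ U_j ∩ U_k)` with the usual differentials
`(d⁰ b)_{ij} = b_j - b_i`, `(d¹ c)_{ijk} = c_{jk} - c_{ik} + c_{ij}` (The Stacks Project, Tag 01ED,
Cohomology, Section 20.9, with all ordered tuples `(i₀, …, i_p) ∈ I^{p+1}`, Tag 01EF) — and the
first Čech cohomology `Ȟ¹(𝒰, 𝒪_X) = ker d¹ / im d⁰` (`CechH1 f U`), an `A`-module through
`A → Γ(X, 𝒪_X) → Γ(X, U_i ∩ U_j)` (`Sections f V` is `Γ(X, V)` with this `A`-algebra structure).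
We also record the data of the connecting homomorphism `H⁰(X_n, 𝒪) → Ȟ¹(𝒰, 𝒪_X)` of the exact
sequences `0 → 𝒪_X → 𝒪_X → 𝒪_{X_n} → 0` for a principal ideal `I = (π)` (`LiftData`: local lifts
`m_i` of a function `s` on `X_n = X ×_A A/π^{n+1}` and the cocycle `c = (m_j - m_i)/π^{n+1}`,
`LiftData.cls`), used in the sibling proofs file to derive the theorem on formal functions from
the finiteness of `Ȟ¹`.

The NAMED FACT `cechH1_finite` (a sorry-free `Prop` definition; users take
`(h : cechH1_finite)`) is the finiteness of coherent cohomology under proper morphisms, The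
Stacks Project, Tag 02O5 (Cohomology of Schemes, Proposition 30.19.1; affine base: Lemma 30.19.2,
Tag 02O6 — "Let `S = Spec(A)` with `A` a Noetherian ring. Let `f : X → S` be a proper morphism.
Let `𝓕` be a coherent `𝒪_X`-module. Then `H^i(X, 𝓕)` is finite `A`-module for all `i ≥ 0`."),
in the case `i = 1`, `𝓕 = 𝒪_X`, with `H¹(X, 𝒪_X)` computed as the Čech cohomology of a finite
affine open cover: for `X` separated (e.g. proper) the finite intersections of affine opens are
affine (Schemes, Lemma 26.21.7, Tag 01KP), so that `Ȟ¹(𝒰, 𝒪_X) = H¹(X, 𝒪_X)` (Cohomology of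
Schemes, Lemma 30.2.6, Tag 01XD). Mathlib has no sheaf cohomology of schemes, no coherent
sheaves and no Čech cohomology; this is the single deep input left in the discharge of
`Literature.AlgebraicGeometry.Motives.IntegralModel.geometricallyIrreducible_reductionAt` (it implies the surjectivity half of
the theorem on formal functions, `Literature.AlgebraicGeometry.Morphisms.HasSurjectiveFormalFunctions`, for flat proper
schemes over a discrete valuation ring; see the sibling proofs file).

## References

* The Stacks Project, Tag 02O5 (Cohomology of Schemes, Proposition 30.19.1) and Tag 02O6
  (Lemma 30.19.2); Tag 01XD (Lemma 30.2.6); Tag 01ED/01EF (Cohomology, Section 20.9, Čech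
  cohomology); Tag 01KP (Schemes, Lemma 26.21.7).
* A. Grothendieck, EGA III₁, Théorème 3.2.1 (finiteness) and Proposition 1.4.1 (Čech
  cohomology of separated schemes).
* R. Hartshorne, *Algebraic Geometry*, Theorems III.4.5 and III.5.2, Remark III.8.8.1.
* J.-P. Serre, *Faisceaux algébriques cohérents*, Ann. of Math. 61 (1955), n° 66, Théorème 1.
-/

noncomputable section

open CategoryTheory AlgebraicGeometry Limits TopologicalSpace Opposite

universe u v

namespace Literature.AlgebraicGeometry.Morphisms

variable {A : Type u} [CommRing A] {X : Scheme.{u}} (f : X ⟶ Spec (.of A))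

/-- The ring of sections `Γ(X, V)` of the structure sheaf over an open `V` of an `A`-scheme
`f : X → Spec A`, as an `A`-algebra through `A → Γ(X, 𝒪_X) → Γ(X, V)` (a type synonym of
`Γ(X, V)` carrying the `A`-algebra instance, which depends on `f`). [folklore] -/
def Sections (_f : X ⟶ Spec (.of A)) (V : X.Opens) : Type u := Γ(X, V)

namespace Sections

variable (V : X.Opens)

/-- The ring structure of `Γ(X, V)`. [folklore] -/
instance : CommRing (Sections f V) := inferInstanceAs (CommRing Γ(X, V))

/-- The identification `Sections f V = Γ(X, V)` as a ring isomorphism. [folklore] -/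
def equiv : Sections f V ≃+* Γ(X, V) := RingEquiv.refl _

/-- The `A`-algebra structure `A → Γ(X, 𝒪_X) → Γ(X, V)`. [folklore] -/
instance : Algebra A (Sections f V) :=
  ((X.presheaf.map (homOfLE (le_top : V ≤ ⊤)).op).hom.comp (algebraMapΓ f)).toAlgebra

/-- Unfolding of the `A`-algebra structure of `Sections f V`. [folklore] -/
theorem algebraMap_apply (a : A) :
    algebraMap A (Sections f V) a =
      X.presheaf.map (homOfLE (le_top : V ≤ ⊤)).op (algebraMapΓ f a) :=
  rfl

variable {V}

/-- Restriction of sections to a smaller open, an `A`-algebra homomorphism. [folklore] -/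
def res {W : X.Opens} (h : W ≤ V) : Sections f V →ₐ[A] Sections f W :=
  { (X.presheaf.map (homOfLE h).op).hom with
    commutes' := fun a ↦ by
      change (X.presheaf.map (homOfLE (le_top : V ≤ ⊤)).op ≫ X.presheaf.map (homOfLE h).op)
          (algebraMapΓ f a) = X.presheaf.map (homOfLE (le_top : W ≤ ⊤)).op (algebraMapΓ f a)
      rw [← Functor.map_comp]
      rfl }

/-- `res` is the restriction map of the structure sheaf. [folklore] -/
theorem res_apply {W : X.Opens} (h : W ≤ V) (s : Sections f V) :
    res f h s = X.presheaf.map (homOfLE h).op s :=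
  rfl

/-- Restriction to the same open is the identity. [folklore] -/
@[simp]
theorem res_self (s : Sections f V) : res f (le_refl V) s = s := by
  have : (homOfLE (le_refl V)).op = 𝟙 (op V) := Subsingleton.elim _ _
  rw [res_apply, this, X.presheaf.map_id]
  rfl

/-- Restriction is transitive. [folklore] -/
@[simp]
theorem res_res {W W' : X.Opens} (h : W ≤ V) (h' : W' ≤ W) (s : Sections f V) :
    res f h' (res f h s) = res f (h'.trans h) s := by
  change (X.presheaf.map (homOfLE h).op ≫ X.presheaf.map (homOfLE h').op) s = _
  rw [← Functor.map_comp]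
  rfl

/-- Proof-irrelevance of the inequality in `res` (restrictions along equal opens agree).
[folklore] -/
theorem res_eq_res {W : X.Opens} (h h' : W ≤ V) (s : Sections f V) : res f h s = res f h' s :=
  rfl

end Sections

/-! ## The Čech complex of the structure sheaf in degrees `≤ 2` -/

section Cech

variable {ι : Type v} (U : ι → X.Opens)

/-- Čech `0`-cochains `Č⁰(𝒰, 𝒪_X) = Π_i Γ(X, U_i)`. [cite: StacksProject, Tag 01ED (Cohomology, Section 20.9)] -/
abbrev CechC0 : Type (max u v) := (i : ι) → Sections f (U i)

/-- Čech `1`-cochains `Č¹(𝒰, 𝒪_X) = Π_{i,j} Γ(X, U_i ∩ U_j)` (all ordered pairs). [cite: StacksProject, Tag 01ED (Cohomology, Section 20.9)] -/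
abbrev CechC1 : Type (max u v) := (i j : ι) → Sections f (U i ⊓ U j)

/-- Čech `2`-cochains `Č²(𝒰, 𝒪_X) = Π_{i,j,k} Γ(X, U_i ∩ U_j ∩ U_k)` (all ordered triples). [cite: StacksProject, Tag 01ED (Cohomology, Section 20.9)] -/
abbrev CechC2 : Type (max u v) := (i j k : ι) → Sections f (U i ⊓ U j ⊓ U k)

/-- The Čech differential `d⁰ : Č⁰ → Č¹`, `(d⁰ b)_{ij} = b_j |_{U_i ∩ U_j} - b_i |_{U_i ∩ U_j}`. [cite: StacksProject, Tag 01ED (Cohomology, Section 20.9)] -/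
def cechD0 : CechC0 f U →ₗ[A] CechC1 f U where
  toFun b i j := Sections.res f inf_le_right (b j) - Sections.res f inf_le_left (b i)
  map_add' b b' := by ext i j; simp only [Pi.add_apply, map_add]; abel
  map_smul' a b := by ext i j; simp only [Pi.smul_apply, map_smul, RingHom.id_apply, smul_sub]

/-- The Čech differential `d¹ : Č¹ → Č²`,
`(d¹ c)_{ijk} = c_{jk} |_{U_{ijk}} - c_{ik} |_{U_{ijk}} + c_{ij} |_{U_{ijk}}`. [cite: StacksProject, Tag 01ED (Cohomology, Section 20.9)] -/
def cechD1 : CechC1 f U →ₗ[A] CechC2 f U where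
  toFun c i j k :=
    Sections.res f (le_inf (inf_le_left.trans inf_le_right) inf_le_right) (c j k) -
      Sections.res f (le_inf (inf_le_left.trans inf_le_left) inf_le_right) (c i k) +
        Sections.res f inf_le_left (c i j)
  map_add' c c' := by ext i j k; simp only [Pi.add_apply, map_add]; abel
  map_smul' a c := by
    ext i j k; simp only [Pi.smul_apply, map_smul, RingHom.id_apply, smul_sub, smul_add]

/-- Unfolding of `cechD0`. [folklore] -/
theorem cechD0_apply (b : CechC0 f U) (i j : ι) :
    cechD0 f U b i j = Sections.res f inf_le_right (b j) - Sections.res f inf_le_left (b i) :=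
  rfl

/-- Unfolding of `cechD1`. [folklore] -/
theorem cechD1_apply (c : CechC1 f U) (i j k : ι) :
    cechD1 f U c i j k =
      Sections.res f (le_inf (inf_le_left.trans inf_le_right) inf_le_right) (c j k) -
        Sections.res f (le_inf (inf_le_left.trans inf_le_left) inf_le_right) (c i k) +
          Sections.res f inf_le_left (c i j) :=
  rfl

/-- `d¹ ∘ d⁰ = 0`. [cite: StacksProject, Tag 01ED (Cohomology, Section 20.9)] -/
theorem cechD1_cechD0 (b : CechC0 f U) : cechD1 f U (cechD0 f U b) = 0 := by
  ext i j k
  simp only [cechD1_apply, cechD0_apply, map_sub, Sections.res_res, Pi.zero_apply]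
  rw [Sections.res_eq_res f _ ((inf_le_left.trans inf_le_left : U i ⊓ U j ⊓ U k ≤ U i)) (b i),
    Sections.res_eq_res f _ ((inf_le_left.trans inf_le_right : U i ⊓ U j ⊓ U k ≤ U j)) (b j),
    Sections.res_eq_res f _ ((inf_le_right : U i ⊓ U j ⊓ U k ≤ U k)) (b k)]
  abel

/-- `im d⁰ ⊆ ker d¹`. [folklore] -/
theorem cechD1_comp_cechD0 : cechD1 f U ∘ₗ cechD0 f U = 0 :=
  LinearMap.ext (cechD1_cechD0 f U)

/-- Čech `1`-cocycles `Ž¹(𝒰, 𝒪_X) = ker d¹`. [cite: StacksProject, Tag 01ED (Cohomology, Section 20.9)] -/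
def cechZ1 : Submodule A (CechC1 f U) := LinearMap.ker (cechD1 f U)

/-- Čech `1`-coboundaries `B̌¹(𝒰, 𝒪_X) = im d⁰`. [cite: StacksProject, Tag 01ED (Cohomology, Section 20.9)] -/
def cechB1 : Submodule A (CechC1 f U) := LinearMap.range (cechD0 f U)

/-- Membership in `Ž¹`. [folklore] -/
theorem mem_cechZ1_iff (c : CechC1 f U) : c ∈ cechZ1 f U ↔ cechD1 f U c = 0 := LinearMap.mem_ker

/-- Membership in `B̌¹`. [folklore] -/
theorem mem_cechB1_iff (c : CechC1 f U) : c ∈ cechB1 f U ↔ ∃ b, cechD0 f U b = c :=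
  LinearMap.mem_range

/-- `B̌¹ ⊆ Ž¹`. [folklore] -/
theorem cechB1_le_cechZ1 : cechB1 f U ≤ cechZ1 f U := by
  rintro c ⟨b, rfl⟩
  exact cechD1_cechD0 f U b

/-- The first Čech cohomology `Ȟ¹(𝒰, 𝒪_X) = Ž¹ / B̌¹` of the structure sheaf with respect to the
family of opens `U`, an `A`-module. For `X` separated and the `U_i` affine (covering `X`) this is
`H¹(X, 𝒪_X)` (The Stacks Project, Tag 01XD = Cohomology of Schemes, Lemma 30.2.6, with Tag 01KP).
[cite: StacksProject, Tag 01ED (Cohomology, Section 20.9) and Tag 01XD (Cohomology of Schemes, Lemma 30.2.6)] -/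
abbrev CechH1 : Type (max u v) :=
  ↥(cechZ1 f U) ⧸ (cechB1 f U).comap (cechZ1 f U).subtype

/-- The class of a `1`-cocycle in `Ȟ¹`. [folklore] -/
def CechH1.mk : ↥(cechZ1 f U) →ₗ[A] CechH1 f U := Submodule.mkQ _

/-- `CechH1.mk` is surjective. [folklore] -/
theorem CechH1.mk_surjective : Function.Surjective (CechH1.mk f U) := Submodule.mkQ_surjective _

/-- A cocycle has class `0` iff it is a coboundary. [folklore] -/
theorem CechH1.mk_eq_zero_iff (z : cechZ1 f U) :
    CechH1.mk f U z = 0 ↔ (z : CechC1 f U) ∈ cechB1 f U := by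
  rw [CechH1.mk, Submodule.mkQ_apply, Submodule.Quotient.mk_eq_zero, Submodule.mem_comap]
  rfl

end Cech


/-! ## The connecting homomorphism `H⁰(X_n, 𝒪) → Ȟ¹(𝒰, 𝒪_X)` for `I = (π)`: lift data -/

section Connecting

open infinitesimalNeighbourhood

variable (I : Ideal A)

/-- Pull-back of functions on an open `W ⊆ X` to `W_n = ι_n⁻¹(W) ⊆ X_n`, as a ring homomorphism
out of `Sections f W`. [folklore] -/
abbrev appι (n : ℕ) (W : X.Opens) :
    Sections f W →+* Γ(infinitesimalNeighbourhood I f n, (ι I f n) ⁻¹ᵁ W) :=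
  ((ι I f n).app W).hom

/-- `appι` commutes with restriction: `(res t)|_{W'_n} = (t|_{W_n})|`. [folklore] -/
theorem appι_res (n : ℕ) {W W' : X.Opens} (h : W' ≤ W) (t : Sections f W) :
    appι f I n W' (Sections.res f h t) =
      (infinitesimalNeighbourhood I f n).presheaf.map (homOfLE ((ι I f n).preimage_mono h)).op
        (appι f I n W t) := by
  change (X.presheaf.map (homOfLE h).op ≫ (ι I f n).app W') t = _
  rw [(ι I f n).naturality]
  rfl

/-- Constants `a ∈ I^{n+1}` vanish on `W_n`. [folklore] -/
theorem appι_algebraMap_eq_zero (n : ℕ) (W : X.Opens) {a : A} (ha : a ∈ I ^ (n + 1)) :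
    appι f I n W (algebraMap A (Sections f W) a) = 0 := by
  change ((X.presheaf.map (homOfLE (le_top : W ≤ ⊤)).op ≫ (ι I f n).app W))
    (algebraMapΓ f a) = 0
  rw [(ι I f n).naturality]
  change (infinitesimalNeighbourhood I f n).presheaf.map _ (restrict I f n (algebraMapΓ f a)) = 0
  rw [restrict_map_mem_pow I f n ha, map_zero]

/-- Conversely `π^{n+1} c` vanishes on `W_n` (for `I = (π)`). [folklore] -/
theorem appι_pow_smul (π : A) (n : ℕ) (W : X.Opens) (c : Sections f W) :
    appι f (Ideal.span {π}) n W (π ^ (n + 1) • c) = 0 := by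
  rw [Algebra.smul_def, map_mul, appι_algebraMap_eq_zero f (Ideal.span {π}) n W
    (Ideal.pow_mem_pow (Ideal.mem_span_singleton_self π) _), zero_mul]

variable (π : A) {ι' : Type v} (U : ι' → X.Opens)

/-- **Lift data** for a function `s` on `X_n` with respect to the cover `𝒰`: local lifts
`m_i ∈ Γ(X, U_i)` of `s |_{(U_i)_n}` together with the Čech `1`-cochain `c` with
`π^{n+1} c = d⁰ m` (which exists and is unique when the `U_i` are affine, `X` is flat over `A`
and `π` is a non-zero-divisor: `LiftData.nonempty` in the sibling proofs file); `c` is then a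
cocycle, whose class in `Ȟ¹(𝒰, 𝒪_X)` is the image of `s` under the connecting homomorphism of
`0 → 𝒪_X → 𝒪_X → 𝒪_{X_n} → 0` (`LiftData.cls`). [folklore] -/
structure LiftData (n : ℕ) (s : Γ(infinitesimalNeighbourhood (Ideal.span {π}) f n, ⊤)) where
  /-- local lifts of `s` -/
  m : CechC0 f U
  /-- the `m_i` lift `s |_{(U_i)_n}` -/
  hm : ∀ i, appι f (Ideal.span {π}) n (U i) (m i) =
    resTop (infinitesimalNeighbourhood (Ideal.span {π}) f n) ((ι (Ideal.span {π}) f n) ⁻¹ᵁ (U i)) s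
  /-- the cochain `(m_j - m_i) / π^{n+1}` -/
  c : CechC1 f U
  /-- `π^{n+1} c = d⁰ m` -/
  hc : π ^ (n + 1) • c = cechD0 f U m
  /-- `c` is a cocycle -/
  c_mem : c ∈ cechZ1 f U

namespace LiftData

variable {f π U} {n : ℕ} {s : Γ(infinitesimalNeighbourhood (Ideal.span {π}) f n, ⊤)}

/-- The pull-back of `(d⁰ m)_{ij}` to `(U_i ∩ U_j)_n` vanishes when the `m_i` lift the same
function `s`. [folklore] -/
theorem appι_cechD0_eq_zero (m : CechC0 f U)
    (hm : ∀ i, appι f (Ideal.span {π}) n (U i) (m i) =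
      resTop (infinitesimalNeighbourhood (Ideal.span {π}) f n)
        ((ι (Ideal.span {π}) f n) ⁻¹ᵁ (U i)) s) (i j : ι') :
    appι f (Ideal.span {π}) n (U i ⊓ U j) (cechD0 f U m i j) = 0 := by
  have key : ∀ (k : ι') (h : U i ⊓ U j ≤ U k),
      appι f (Ideal.span {π}) n (U i ⊓ U j) (Sections.res f h (m k)) =
        resTop (infinitesimalNeighbourhood (Ideal.span {π}) f n)
          ((ι (Ideal.span {π}) f n) ⁻¹ᵁ (U i ⊓ U j)) s := by
    intro k h
    rw [appι_res, hm k, map_resTop]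
  rw [cechD0_apply, map_sub, key j inf_le_right, key i inf_le_left, sub_self]

variable (D : LiftData f π U n s)

/-- The class `x_n(s) ∈ Ȟ¹(𝒰, 𝒪_X)` of lift data (the image of `s` under the connecting
homomorphism `H⁰(X_n, 𝒪) → Ȟ¹(𝒰, 𝒪_X)`). [folklore] -/
def cls : CechH1 f U := CechH1.mk f U ⟨D.c, D.c_mem⟩

/-- Lift data for `s_{n+1}` on `X_{n+1}` give lift data for `s_n = s_{n+1} |_{X_n}` on `X_n` with
the same local lifts and the cochain multiplied by `π`. [folklore] -/
def ofSucc {s' : Γ(infinitesimalNeighbourhood (Ideal.span {π}) f (n + 1), ⊤)}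
    (D' : LiftData f π U (n + 1) s')
    (hs : (transition (Ideal.span {π}) f n).appTop.hom s' = s) : LiftData f π U n s where
  m := D'.m
  hm i := by
    set g₁ := ι (Ideal.span {π}) f (n + 1)
    set t := transition (Ideal.span {π}) f n
    have e := Scheme.Hom.congr_app (transition_ι (Ideal.span {π}) f n).symm (U i)
    change ((ι (Ideal.span {π}) f n).app (U i)).hom (D'.m i) = _
    rw [e, Scheme.Hom.comp_app]
    change ((infinitesimalNeighbourhood (Ideal.span {π}) f n).presheaf.map (eqToHom _).op)
      ((t.app _) (appι f (Ideal.span {π}) (n + 1) (U i) (D'.m i))) = _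
    rw [D'.hm i, app_resTop, hs, map_resTop']
  c := π • D'.c
  hc := by rw [smul_smul, ← pow_succ, D'.hc]
  c_mem := Submodule.smul_mem _ _ D'.c_mem

/-- The class for `s_n` is `π` times the class for `s_{n+1}`. [folklore] -/
theorem cls_ofSucc {s' : Γ(infinitesimalNeighbourhood (Ideal.span {π}) f (n + 1), ⊤)}
    (D' : LiftData f π U (n + 1) s')
    (hs : (transition (Ideal.span {π}) f n).appTop.hom s' = s) :
    (D'.ofSucc hs).cls = π • D'.cls := by
  rw [cls, cls, ← map_smul]
  rfl

end LiftData

end Connecting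

/-! ## Finiteness of `H¹(X, 𝒪_X)` for proper `X → Spec A` (Stacks Project, Tag 02O5) -/

/-- NAMED FACT — **coherence of higher direct images under proper morphisms, case
`H¹(X, 𝒪_X)` over an affine Noetherian base** (The Stacks Project, Tag 02O5 = Cohomology of
Schemes, Proposition 30.19.1, in its affine form Tag 02O6 = Lemma 30.19.2: "Let `S = Spec(A)` with
`A` a Noetherian ring. Let `f : X → S` be a proper morphism. Let `𝓕` be a coherent `𝒪_X`-module.
Then `H^i(X, 𝓕)` is finite `A`-module for all `i ≥ 0`."), for `i = 1` and `𝓕 = 𝒪_X`, with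
`H¹(X, 𝒪_X)` computed as the Čech cohomology `Ȟ¹(𝒰, 𝒪_X)` (`CechH1`) of any finite affine open
cover `𝒰` of `X`: since `X` is separated, the finite intersections of the affine opens `U_i` are
affine (Schemes, Lemma 26.21.7, Tag 01KP), so `Ȟ¹(𝒰, 𝒪_X) = H¹(X, 𝒪_X)` by Cohomology of Schemes,
Lemma 30.2.6 (Tag 01XD). Users take `(h : cechH1_finite)`.
[cite: StacksProject, Tag 02O5 (Cohomology of Schemes, Proposition 30.19.1 and Lemma 30.19.2, case i = 1 and F = O_X, via Tags 01XD and 01KP)] -/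
def cechH1_finite : Prop :=
  ∀ ⦃A : Type u⦄ [CommRing A] [IsNoetherianRing A] ⦃X : Scheme.{u}⦄ (f : X ⟶ Spec (.of A))
    [IsProper f] ⦃ι : Type u⦄ [Finite ι] (U : ι → X.Opens),
    (∀ i, IsAffineOpen (U i)) → ⨆ i, U i = ⊤ → Module.Finite A (CechH1 f U)

end Literature.AlgebraicGeometry.Morphisms

end
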